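import Summits.Parity.GeneralizedHardyLittlewood.Theses.LiouvilleShiftedTables
import Summits.Parity.GeneralizedHardyLittlewood.Theorems.LiouvilleShiftedTablesEHLevelClosure
import Summits.Parity.GeneralizedHardyLittlewood.Theorems.LiouvilleShiftedTablesElliottHalberstamLiftingMultiples

/-!
# STRATEGY-CENSUS companion (crux stmt-Parity-11314 `EH`) — typed objects of the four lenses

Author: planner-cstrat-stmt-Parity-11314-p1-0 (crux-strategist, wall-breaker pass p1), 2026-08-17.
`sorry`-free.  Everything here is either a SIGNATURE quoted in `STRATEGY-CENSUS.md` or a short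
kernel certificate that a lens has no teeth on this crux:

* `## Strengthen`: `MontgomeryShape` (S⁺₁), `PowerSavingEH` (S⁺₂), `InductiveStep` (S⁺₃, the
  strengthen-to-induct form) with `eh_iff_inductiveStep : EH ↔ InductiveStep` — the induction step on the
  level IS the crux (given the Bombieri–Vinogradov endpoint `primesHaveLevel_half`, p106857).
* `## Decomposition`: `PrimeModuliLevel` / `CompositeModuliLevel` with
  `eh_iff_compositeModuli : EH ↔ ∀ θ < 1, CompositeModuliLevel θ` — the "prime moduli vs composite moduli"
  split is a costume: the composite piece alone is the crux (W-trick `elliottHalberstam_iff_multiples_const`,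
  p86337, with `k₀ = 4`), the prime piece is logically redundant although methodologically it is the
  irreducible core.
* `## Transfer`: `FixedResidueLevel b θ` (the fixed-residue sibling that HAS theorems beyond 1/2 and is
  what the three consumer routes use), `eh_imp_fixedResidue_shape` is NOT proved here (it is
  `weakEHUniform_of_eh` of `Cruxes/EH/SketchIdeator1.lean`); the converse direction is the open gap.
* `## Negation`: `LeastPrimeFloor` — the sharpened floor `E*(x;q) ≫ log q` (prime-free reduced class
  below `φ(q) log q / 2`, pigeonhole + Chebyshev), typed as a `-- Targets` candidate for the disprover;
  it moves the unconditional lower bound from `Q − 1` (Disproof §1) to `≍ Q log Q`, still `x^{θ+o(1)}`.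
-/

open Filter Asymptotics Finset
open Literature.NumberTheory.Sieve

namespace Summit.Parity.GeneralizedHardyLittlewood.Cruxes.EH.StrategyCensus

open Summit.Parity.GeneralizedHardyLittlewood.Theses.LiouvilleShiftedTables (EH)

/-! ### Strengthen -/

/-- **S⁺₁ — Montgomery's conjecture** in the Friedlander–Granville-safe range `q ≤ x^{1−ε}`:
`E*(x; q) ≪_ε x^ε (x/q)^{1/2}`.  Implies `EH` (sum over `q ≤ x^θ`: `≪ x^{(1+θ)/2+ε}`); pointwise in `q`,
hence attackable only character by character — "beyond GRH" (GRH gives `x^{1/2} log² x`, which is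
`(x/q)^{1/2}` only for bounded `q`).  [Montgomery 1971; modified range: Friedlander–Granville 1989] -/
def MontgomeryShape : Prop :=
  ∀ ε : ℝ, 0 < ε → ∃ C x₀ : ℝ, ∀ x : ℝ, x₀ ≤ x → ∀ q : ℕ, 1 ≤ q → (q : ℝ) ≤ x ^ (1 - ε) →
    primeAPError x q ≤ C * x ^ ε * (x / q) ^ (1 / 2 : ℝ)

/-- **S⁺₂ — pointwise power saving** (`∀ θ ∃ δ`; the uniform `∃ δ ∀ θ` form is FALSE,
`Disproof.not_uniformPowerSaving`).  Strictly stronger than `EH`, same walls. -/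
def PowerSavingEH : Prop :=
  ∀ θ : ℝ, θ < 1 → ∃ δ : ℝ, 0 < δ ∧
    (fun x : ℝ => ∑ q ∈ Icc 1 ⌊x ^ θ⌋₊, primeAPError x q) =O[atTop] fun x : ℝ => x ^ (1 - δ)

/-- **S⁺₃ — strengthen-to-induct**: the self-improvement step "level `θ` ⇒ level `(1+θ)/2`"
on `[1/2, 1)`. -/
def InductiveStep : Prop :=
  ∀ θ : ℝ, 1 / 2 ≤ θ → θ < 1 → PrimesHaveLevel θ → PrimesHaveLevel ((1 + θ) / 2)

theorem inductiveStep_of_eh (h : EH) : InductiveStep :=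
  fun θ _ hθ _ => h _ (by linarith)

/-- Iterating the step from the Bombieri–Vinogradov endpoint: level `1 − 2^{−(n+1)}` for every `n`. -/
theorem primesHaveLevel_iter (hS : InductiveStep) (n : ℕ) :
    PrimesHaveLevel (1 - (1 / 2 : ℝ) ^ (n + 1)) := by
  induction n with
  | zero =>
    have h := _root_.Summit.Parity.GeneralizedHardyLittlewood.Theorems.EH.LevelClosure.primesHaveLevel_half
    convert h using 1
    norm_num
  | succ n ih =>
    have hpow : (1 / 2 : ℝ) ^ (n + 1) ≤ 1 / 2 := by
      calc (1 / 2 : ℝ) ^ (n + 1) ≤ (1 / 2 : ℝ) ^ 1 :=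
            pow_le_pow_of_le_one (by norm_num) (by norm_num) (by omega)
        _ = 1 / 2 := by norm_num
    have hpos : 0 < (1 / 2 : ℝ) ^ (n + 1) := by positivity
    have h1 : (1 : ℝ) / 2 ≤ 1 - (1 / 2 : ℝ) ^ (n + 1) := by linarith
    have h2 : 1 - (1 / 2 : ℝ) ^ (n + 1) < 1 := by linarith
    have h := hS _ h1 h2 ih
    convert h using 1
    ring

/-- **The induction step is the crux**: `InductiveStep → EH`. -/
theorem eh_of_inductiveStep (hS : InductiveStep) : EH := by
  intro θ hθ
  obtain ⟨n, hn⟩ := exists_pow_lt_of_lt_one (by linarith : 0 < 1 - θ) (by norm_num : (1 / 2 : ℝ) < 1)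
  refine (primesHaveLevel_iter hS n).mono ?_
  have : (1 / 2 : ℝ) ^ (n + 1) ≤ (1 / 2 : ℝ) ^ n :=
    pow_le_pow_of_le_one (by norm_num) (by norm_num) (Nat.le_succ n)
  linarith

/-- Certificate for `## Strengthen`: the strengthen-to-induct form is kernel-equivalent to the crux. -/
theorem eh_iff_inductiveStep : EH ↔ InductiveStep :=
  ⟨inductiveStep_of_eh, eh_of_inductiveStep⟩

/-! ### Decomposition -/

/-- EH-shape at level `x^{θ−ε}` over PRIME moduli only. -/
def PrimeModuliLevel (θ : ℝ) : Prop :=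
  ∀ A : ℝ, 0 < A → ∀ ε : ℝ, 0 < ε →
    (fun x : ℝ => ∑ q ∈ (Icc 1 ⌊x ^ (θ - ε)⌋₊).filter (fun q => q.Prime), primeAPError x q)
      =O[atTop] fun x : ℝ => x / Real.log x ^ A

/-- EH-shape at level `x^{θ−ε}` over NON-PRIME moduli only. -/
def CompositeModuliLevel (θ : ℝ) : Prop :=
  ∀ A : ℝ, 0 < A → ∀ ε : ℝ, 0 < ε →
    (fun x : ℝ => ∑ q ∈ (Icc 1 ⌊x ^ (θ - ε)⌋₊).filter (fun q => ¬ q.Prime), primeAPError x q)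
      =O[atTop] fun x : ℝ => x / Real.log x ^ A

theorem compositeModuli_of_eh (h : EH) : ∀ θ : ℝ, θ < 1 → CompositeModuliLevel θ := by
  intro θ hθ A hA ε hε
  have h' : PrimesHaveLevel θ := h θ hθ
  refine IsBigO.trans (IsBigO.of_bound 1 ?_) (h' A hA ε hε)
  filter_upwards with x
  have h0 : ∀ q, 0 ≤ primeAPError x q := fun q => primeAPError_nonneg x q
  rw [one_mul, Real.norm_eq_abs, Real.norm_eq_abs,
    abs_of_nonneg (Finset.sum_nonneg fun q _ => h0 q), abs_of_nonneg (Finset.sum_nonneg fun q _ => h0 q)]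
  exact Finset.sum_le_sum_of_subset_of_nonneg (Finset.filter_subset _ _) fun q _ _ => h0 q

/-- **The composite piece alone is the crux** (W-trick with `k₀ = 4`: every multiple of `4` is
non-prime, and `EH ↔` its restriction to multiples of `4`, p86337). -/
theorem eh_of_compositeModuli (h : ∀ θ : ℝ, θ < 1 → CompositeModuliLevel θ) : EH := by
  show LevelOfDistribution.ElliottHalberstam
  refine (_root_.Summit.Parity.GeneralizedHardyLittlewood.Theorems.ElliottHalberstam.Lifting.elliottHalberstam_iff_multiples_const
    (k₀ := 4) (by norm_num)).mpr ?_
  intro θ hθ A hA ε hε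
  refine IsBigO.trans (IsBigO.of_bound 4 ?_) (h θ hθ A hA ε hε)
  filter_upwards with x
  have h0 : ∀ q, 0 ≤ primeAPError x q := fun q => primeAPError_nonneg x q
  have hsub : (Icc 1 ⌊x ^ (θ - ε)⌋₊).filter (fun q => 4 ∣ q) ⊆
      (Icc 1 ⌊x ^ (θ - ε)⌋₊).filter (fun q => ¬ q.Prime) := by
    intro q hq
    simp only [Finset.mem_filter] at hq ⊢
    refine ⟨hq.1, fun hp => ?_⟩
    rcases hp.eq_one_or_self_of_dvd 4 hq.2 with h4 | h4
    · omega
    · subst h4; exact absurd hp (by decide)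
  have hle : ∑ q ∈ (Icc 1 ⌊x ^ (θ - ε)⌋₊).filter (fun q => 4 ∣ q), primeAPError x q ≤
      ∑ q ∈ (Icc 1 ⌊x ^ (θ - ε)⌋₊).filter (fun q => ¬ q.Prime), primeAPError x q :=
    Finset.sum_le_sum_of_subset_of_nonneg hsub fun q _ _ => h0 q
  rw [Real.norm_eq_abs, Real.norm_eq_abs,
    abs_of_nonneg (mul_nonneg (by norm_num) (Finset.sum_nonneg fun q _ => h0 q)),
    abs_of_nonneg (Finset.sum_nonneg fun q _ => h0 q)]
  push_cast
  linarith

/-- Certificate for `## Decomposition`: `EH ↔ ∀ θ < 1, CompositeModuliLevel θ`; so in the split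
`PrimeModuliLevel ∧ CompositeModuliLevel → EH` the prime-moduli piece is logically redundant and the
composite piece is the whole crux. -/
theorem eh_iff_compositeModuli : EH ↔ ∀ θ : ℝ, θ < 1 → CompositeModuliLevel θ :=
  ⟨compositeModuli_of_eh, eh_of_compositeModuli⟩

/-- The two-piece split composes (trivially, through the composite piece only). -/
theorem eh_of_prime_and_composite (_hP : ∀ θ : ℝ, θ < 1 → PrimeModuliLevel θ)
    (hC : ∀ θ : ℝ, θ < 1 → CompositeModuliLevel θ) : EH :=
  eh_of_compositeModuli hC

/-! ### Transfer -/

open Classical in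
/-- `E_b(x; q) = max_{1 ≤ y ≤ x} |ψ(y; q, b) − y/φ(q)|` for the single class `b mod q`, `0` if
`(b, q) > 1` (same body as `Cruxes/EH/SketchIdeator1.fixedResidueError`). -/
noncomputable def fixedResidueError (x : ℝ) (q : ℕ) (b : ℤ) : ℝ :=
  if IsUnit (b : ZMod q) then
    ⨆ y : Set.Icc (1 : ℝ) x, |LevelOfDistribution.chebyshevPsiMod q (b : ZMod q) y - (y : ℝ) / Nat.totient q|
  else 0

/-- **The solved-in-part sibling**: fixed-residue level of distribution `x^θ` for ONE integer class
`b` (BFI 1986 Thm 10: `θ = 4/7` with well-factorable weights; Maynard 2020/25: `3/5`; Lichtman,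
Pascadi: `5/8`-type for structured weights; BFI-II: just beyond `1/2` with absolute values).  This —
at `b = ±h` — is all that `PairsFromMAvg` / `LevelToPairs` / `ShiftedPrimesBombieri` consume. -/
def FixedResidueLevel (b : ℤ) (θ : ℝ) : Prop :=
  ∀ A : ℝ, 0 < A → ∀ ε : ℝ, 0 < ε →
    (fun x : ℝ => ∑ q ∈ Icc 1 ⌊x ^ (θ - ε)⌋₊, fixedResidueError x q b) =O[atTop]
      fun x : ℝ => x / Real.log x ^ A

/-- The weakest bridge premise the three consumer routes could be re-badged on (tenure business,
recorded for the human): fixed-residue EH at every shift. -/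
def FixedResidueEH : Prop := ∀ b : ℤ, b ≠ 0 → ∀ θ : ℝ, θ < 1 → FixedResidueLevel b θ

/-! ### Negation -/

/-- **Sharpened floor (Target candidate for the disprover)**: some reduced class mod `q` contains no
prime power `≤ φ(q) log q / 2` (pigeonhole against Chebyshev), so `E*(x; q) ≥ (log q)/2 − O(1)` once
`q log q ≤ x`.  Summed over `q ≤ x^θ` this is `≍ θ x^θ log x` — still short of `x/(log x)^A` by
`x^{1−θ−o(1)}`: emptiness at height `q^{1+o(1)}` never contradicts an average at height `x`. -/
def LeastPrimeFloor : Prop :=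
  ∃ c : ℝ, 0 < c ∧ ∀ᶠ x : ℝ in atTop, ∀ q : ℕ, 3 ≤ q → (q : ℝ) * Real.log q ≤ x →
    c * Real.log q ≤ primeAPError x q

end Summit.Parity.GeneralizedHardyLittlewood.Cruxes.EH.StrategyCensus
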